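import Summits.HodgeConjecture.HodgeConjecture.Theorems.HodgeSimilitudeAlgebraic.Negative.FalseWithoutHtype
import Summits.HodgeConjecture.HodgeConjecture.Theorems.NikulinTwinTransportTwinSimilitudeAlgebraicLattice
import Summits.HodgeConjecture.HodgeConjecture.Theorems.NikulinTwinTransportTwinSimilitudeAlgebraicMarkings

/-!
# `TwinSimilitudeAlgebraic` (stmt-HodgeConjecture-13674, X = Sim₂(K3)) · Negative · the type hypothesis is load-bearing

Negative-side knowledge for the crux `NikulinTwinTransport.TwinSimilitudeAlgebraic` (every rational,
type-preserving `2`-similitude `ψ : H²(S′(ℂ);ℂ) → H²(S(ℂ);ℂ)` between projective K3 surfaces is induced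
by an algebraic class), extracted from the standing disprover's work file
`Cruxes/TwinSimilitudeAlgebraic/Disproof.lean` (§3; refuter-cdisprove-stmt-HodgeConjecture-13674-0,
cycle 1, 2026-08-16). Multiplier-`2` companion of the landed multiplier-`1` lemma
`HodgeSimilitudeAlgebraic.Negative.hodgeSimilitudeAlgebraic_false_without_htype_at_one`.

`twinSimilitudeAlgebraic_false_without_htype`: the crux X with its type-preservation hypothesis
DROPPED is FALSE on the tree's real carriers, for every orientation family with Poincaré duality,
granted the same five named facts (`Huybrechts_K3_periodSurjective_projective`,
`hodgePQ_independent_of_hodgeModel`, `nonempty_hodgeModel`, `exists_deRhamIsoFamily`,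
`Grothendieck1969_supportedClasses_le_hodgeConiveau`). Witness: the marked projective K3 surface
`(S, φ)` with the CM period `x₀ = (e₁+f₁) + i(e₂+f₂)`. Under X-without-`htype`, EVERY endomorphism
`ρ` of `Λ_ℂ` defined over `ℚ` doubling the K3 form preserves the period line `ℂx₀`: its conjugate
`φ⁻¹ ∘ ρ ∘ φ` is a rational `2`-similitude of `H²(S(ℂ);ℂ)` (`isRationalClass_markingConj`,
`cupProduct_markingConj`), hence `[γ]_*` for some `γ ∈ N²H⁴(S × S) ⊆ H^{2,2}`, hence
`(2,0)`-preserving (`isOfHodgeType_complexGysin`, `cupPreservesHodgeType_of_nonempty_hodgeModel`,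
`IsOfHodgeType.map_of_independent`). Applied to the rational lattice `2`-similitude `M` of
`exists_twoSimilitude_k3Lattice` (sum/difference on `E₈(−1)²`, `diag(1,2)` on `U³`) and to
`M ∘ s_w`, `w = e₁ + f₁`, the rational inverse `N` of `M` yields `s_w x₀ ∈ ℂ x₀`, contradicting
`reflection_x₀P_ne_smul` (`s_w x₀ = x₀ − 2w`). So any proof of X must use `htype`. No matrix is
unfolded: only the abstract properties of `M, N` are used.

## References

* [Huybrechts2016K3] D. Huybrechts, Lectures on K3 Surfaces (2016), Ch. 6 §1.1, Rem. 3.3; Ch. 14 §0.3.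
* [VoisinHodgeI2002] C. Voisin, Hodge Theory and Complex Algebraic Geometry I (2002), §7.3.2,
  Prop. 11.20.
* [Buskin2019] N. Buskin, Every rational Hodge isometry between two K3 surfaces is algebraic,
  J. reine angew. Math. 755 (2019), §6.2.
-/

noncomputable section

open CategoryTheory MonoidalCategory
open scoped Manifold Matrix
open Literature.AlgebraicGeometry.Motives Literature.AlgebraicGeometry.HodgeTheory
open Literature.AlgebraicGeometry.Surfaces Literature.Geometry.Kaehler
open Literature.AlgebraicTopology.SingularHomology
open Literature.NumberTheory.Transcendental (exists_deRhamIsoFamily)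
open Literature.LinearAlgebra.QuadraticForm
open Summit.HodgeConjecture.HodgeConjecture.Theses.NikulinTwinTransport
open Summit.HodgeConjecture.HodgeConjecture.Theorems.NikulinTwinTransport
open Summit.HodgeConjecture.HodgeConjecture.Theorems.HodgeSimilitudeAlgebraic.Negative

namespace Summit.HodgeConjecture.HodgeConjecture.Theorems.TwinSimilitudeAlgebraic.Negative

/-- `XWithoutHtypeAt[c]`: the body of the route decl `TwinSimilitudeAlgebraic` with its
type-preservation hypothesis dropped and the multiplier `2` replaced by `c : ℂ` (everything else
verbatim; `XWithoutHtypeAt[(2 : ℂ)]` is X minus `htype`, and the notation agrees symbol for symbol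
with `WithoutHtype[c]` of `HodgeSimilitudeAlgebraic/Negative/FalseWithoutHtype`). Local notation only. -/
local notation3 (prettyPrint := false) "XWithoutHtypeAt[" c "]" =>
  ∀ (μ : OrientationFamily), μ.HasPoincareDuality →
    ∀ (S S' : SchemeOver ℂ)
      (hS : (IsSmoothProjective 2 S ∧ Subsingleton (structureSheafCohomology S.left 1) ∧
        ∃ (A : HodgeModel 2 S) (η : MForm 𝓘(ℝ, A.model) A.carrier ℂ 2),
          IsHolomorphicInCharts η ∧ ∀ x, η x ≠ 0))
      (hS' : (IsSmoothProjective 2 S' ∧ Subsingleton (structureSheafCohomology S'.left 1) ∧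
        ∃ (A : HodgeModel 2 S') (η : MForm 𝓘(ℝ, A.model) A.carrier ℂ 2),
          IsHolomorphicInCharts η ∧ ∀ x, η x ≠ 0))
      (p : complexBetti S (2 * 2)) (p' : complexBetti S' (2 * 2)),
      (IsIntegralClass p ∧ ∀ q : complexBetti S (2 * 2), IsIntegralClass q → ∃ n : ℤ, q = n • p) →
      (IsIntegralClass p' ∧
        ∀ q : complexBetti S' (2 * 2), IsIntegralClass q → ∃ n : ℤ, q = n • p') →
      ∀ (ψ : complexBetti S' (2 * 1) →ₗ[ℂ] complexBetti S (2 * 1)),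
        (∀ x, IsRationalClass x → IsRationalClass (ψ x)) →
        (∀ (x y : complexBetti S' (2 * 1)) (a : ℂ),
          cupProduct (rfl : 2 * 1 + 2 * 1 = 2 * 2) x y = a • p' →
            cupProduct (rfl : 2 * 1 + 2 * 1 = 2 * 2) (ψ x) (ψ y) = (c * a) • p) →
        ∃ γ ∈ algebraicClasses (MonoidalCategoryStruct.tensorObj S S') 2,
          ∀ x : complexBetti S' (2 * 1),
            ψ x = complexGysin μ (IsSmoothProjective.tensor_holds hS.1 hS'.1) hS.1
              (SemiCartesianMonoidalCategory.fst S S')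
              (rfl : 2 * 1 + 2 * 2 + 2 * 2 = 2 * 1 + 2 * (2 + 2))
              (cupProduct (rfl : 2 * 1 + 2 * 2 = 2 * 1 + 2 * 2)
                (complexBetti.map (SemiCartesianMonoidalCategory.snd S S') (2 * 1) x) γ)

/-- The explicit projective CM period vector `x₀ = (e₁ + f₁) + i (e₂ + f₂)` (verbatim the local
notation of `Negative/FalseWithoutHtype`). Local notation only. -/
local notation3 (prettyPrint := false) "x₀P" =>
  (Sum.elim 0 (Sum.elim ![1, 1] (Sum.elim ![Complex.I, Complex.I] 0)) : K3Index → ℂ)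

/-- The lattice vector `w = e₁ + f₁`. Local notation only. -/
local notation3 (prettyPrint := false) "wV" =>
  (Sum.elim 0 (Sum.elim ![1, 1] (Sum.elim 0 0)) : K3Index → ℤ)

/-- The lattice vector `u = e₃ + f₃ ⊥ x₀`, `u² = 2`. Local notation only. -/
local notation3 (prettyPrint := false) "uV" =>
  (Sum.elim 0 (Sum.elim 0 (Sum.elim 0 ![1, 1])) : K3Index → ℤ)

/-- **The period line is stable under every rational `c`-similitude of `Λ`, if X-without-`htype`
holds at multiplier `c`.** Granted the five named facts and an orientation family with Poincaré
duality: on the marked projective K3 surface `(S, φ)` with period `x₀ = (e₁+f₁) + i(e₂+f₂)`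
(`Huybrechts_K3_periodSurjective_projective`), every endomorphism `ρ` of `Λ_ℂ` defined over `ℚ` with
`(ρa.ρb) = c (a.b)` yields the rational `c`-similitude `ψ_ρ = φ⁻¹ ∘ ρ ∘ φ` of `H²(S(ℂ); ℂ)`
(`isRationalClass_markingConj`, `cupProduct_markingConj`); `XWithoutHtypeAt[c]` makes `ψ_ρ` equal to
`[γ]_*` for an algebraic `γ ∈ N²H⁴(S × S) ⊆ H^{2,2}` (Grothendieck's coniveau fact), which preserves
the type `(2,0)` (`IsOfHodgeType.map_of_independent`, `cupPreservesHodgeType_of_nonempty_hodgeModel`,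
`isOfHodgeType_complexGysin`); as `H^{2,0}(S) = ℂ φ⁻¹x₀`, `ρ x₀ ∈ ℂ x₀`.
[cite: VoisinHodgeI2002, §7.3.2 and Prop. 11.20] [cite: Huybrechts2016K3, Ch. 6 Rem. 3.3] -/
theorem smul_period_of_withoutHtypeAt
    (hP : Huybrechts_K3_periodSurjective_projective)
    (hI : hodgePQ_independent_of_hodgeModel)
    (hM : ∀ (m : ℕ) (Y : SchemeOver ℂ), nonempty_hodgeModel m Y)
    (hdR : ∀ (E : Type) [NormedAddCommGroup E] [NormedSpace ℂ E] [FiniteDimensional ℂ E],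
      exists_deRhamIsoFamily 𝓘(ℝ, E))
    (hG : Grothendieck1969_supportedClasses_le_hodgeConiveau)
    (μ : OrientationFamily) (hμ : μ.HasPoincareDuality) {c : ℂ} (h : XWithoutHtypeAt[c])
    (ρ : Module.End ℂ (K3Index → ℂ))
    (hρrat : ∀ v : K3Index → ℤ, ∃ w : K3Index → ℚ, ρ (fun i => (v i : ℂ)) = fun i => (w i : ℂ))
    (hρc : ∀ a b, k3Form (ρ a) (ρ b) = c * k3Form a b) :
    ∃ t : ℂ, ρ x₀P = t • x₀P := by
  -- a marked projective K3 surface with period `x₀`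
  obtain ⟨S, hS, φ, p, hpint, hpgen, hφint, hφcup, h20, h20span⟩ :=
    hP x₀P x₀P_sq x₀P_pos ⟨uV, uV_x₀P, uV_sq⟩
  have hp0 : p ≠ 0 := generator_ne_zero hS hpgen
  set ψ : complexBetti S (2 * 1) →ₗ[ℂ] complexBetti S (2 * 1) :=
    φ.symm.toLinearMap ∘ₗ ρ ∘ₗ φ.toLinearMap with hψ
  have hψapply : ∀ y, ψ y = φ.symm (ρ (φ y)) := fun y => rfl
  have hrat : ∀ y, IsRationalClass y → IsRationalClass (ψ y) := by
    intro y hy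
    rw [hψapply]
    exact isRationalClass_markingConj φ φ ρ hS hS hφint hφint hρrat hy
  have hsim : ∀ (x y : complexBetti S (2 * 1)) (a : ℂ),
      cupProduct (rfl : 2 * 1 + 2 * 1 = 2 * 2) x y = a • p →
        cupProduct (rfl : 2 * 1 + 2 * 1 = 2 * 2) (ψ x) (ψ y) = (c * a) • p := by
    intro x y a hxy
    rw [hψapply, hψapply]
    exact cupProduct_markingConj φ p φ p ρ hp0 hφcup hφcup hρc x y a hxy
  -- the mutilated crux makes `ψ` algebraic
  obtain ⟨γ, hγ, hψγ⟩ := h μ hμ S S hS hS p p ⟨hpint, hpgen⟩ ⟨hpint, hpgen⟩ ψ hrat hsim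
  -- `γ ∈ N²H⁴(S × S)` is of type `(2,2)` (Grothendieck's coniveau fact)
  have hSS : IsSmoothProjective (2 + 2) (S ⊗ S) := IsSmoothProjective.tensor_holds hS.1 hS.1
  obtain ⟨A⟩ := (hM (2 + 2) (S ⊗ S)).nonempty hSS
  have hγT : IsOfHodgeType (2 + 2) (S ⊗ S) (2 * 2) 2 2 γ := by
    have hc : A.pullback (2 * 2) γ ∈ A.hodgeConiveau (2 * 2) 2 := hG hSS A (2 * 2) 2 ⟨γ, hγ, rfl⟩
    have hle : A.hodgeConiveau (2 * 2) 2 ≤ A.hodgePQ (2 * 2) 2 2 := by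
      refine iSup_le fun p₁ => iSup_le fun q₁ => iSup_le fun hpq => iSup_le fun hp₁ =>
        iSup_le fun hq₁ => ?_
      obtain ⟨rfl, rfl⟩ : p₁ = 2 ∧ q₁ = 2 := by omega
      exact le_rfl
    exact ⟨A, hle hc⟩
  -- `snd^*(φ⁻¹ x₀)` is of type `(2,0)`, its cup with `γ` of type `(4,2)`, `fst_*` of that of type `(2,0)`
  have hsndT : IsOfHodgeType (2 + 2) (S ⊗ S) (2 * 1) 2 0
      (complexBetti.map (SemiCartesianMonoidalCategory.snd S S) (2 * 1) (φ.symm x₀P)) :=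
    IsOfHodgeType.map_of_independent hI h20 hSS hS.1 A (SemiCartesianMonoidalCategory.snd S S)
  have hcupT := cupPreservesHodgeType_of_nonempty_hodgeModel hI (hM (2 + 2) (S ⊗ S)) hdR hSS
    (rfl : 2 * 1 + 2 * 2 = 2 * 1 + 2 * 2) hsndT hγT
  have hgysT : IsOfHodgeType 2 S (2 * 1) 2 0 (ψ (φ.symm x₀P)) := by
    rw [hψγ]
    exact isOfHodgeType_complexGysin hI hM hdR μ hSS hS.1 (SemiCartesianMonoidalCategory.fst S S)
      (rfl : 2 * 1 + 2 * 2 + 2 * 2 = 2 * 1 + 2 * (2 + 2)) (by norm_num) (by norm_num) hcupT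
  -- hence `ρ x₀ ∈ ℂ x₀`
  obtain ⟨t, ht⟩ := h20span _ hgysT
  refine ⟨t, ?_⟩
  rw [hψapply, LinearEquiv.apply_symm_apply] at ht
  have ht' := congrArg φ ht
  rwa [LinearEquiv.apply_symm_apply, map_smul, LinearEquiv.apply_symm_apply] at ht'

/-- **X-without-`htype` at multiplier `c` is refuted by any rational `c`-similitude of the K3 lattice
with a left inverse** (modulo the five named facts, for every orientation family with PD): apply
`smul_period_of_withoutHtypeAt` to `M` and to `M ∘ s_w` (`w = e₁ + f₁`; `s_w` is a rational isometry,
`k3ReflectionC_ratCast`, `k3Form_k3ReflectionC`), and cancel `M` with its left inverse `N`: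
`s_w x₀ ∈ ℂ x₀`, contradicting `reflection_x₀P_ne_smul` (`s_w x₀ = x₀ − 2w ∉ ℂx₀`). Reusable by the
all-multipliers crux `HodgeSimilitudeAlgebraic` with its rational `q`-similitudes. [folklore] -/
theorem withoutHtypeAt_false_of_latticeSimilitude
    (hP : Huybrechts_K3_periodSurjective_projective)
    (hI : hodgePQ_independent_of_hodgeModel)
    (hM : ∀ (m : ℕ) (Y : SchemeOver ℂ), nonempty_hodgeModel m Y)
    (hdR : ∀ (E : Type) [NormedAddCommGroup E] [NormedSpace ℂ E] [FiniteDimensional ℂ E],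
      exists_deRhamIsoFamily 𝓘(ℝ, E))
    (hG : Grothendieck1969_supportedClasses_le_hodgeConiveau)
    (μ : OrientationFamily) (hμ : μ.HasPoincareDuality) {c : ℂ}
    (M N : Module.End ℂ (K3Index → ℂ))
    (hMrat : ∀ v : K3Index → ℤ, ∃ w : K3Index → ℚ, M (fun i => (v i : ℂ)) = fun i => (w i : ℂ))
    (hNM : N * M = 1) (hMc : ∀ a b, k3Form (M a) (M b) = c * k3Form a b) :
    ¬ XWithoutHtypeAt[c] := by
  intro h
  have hsrat : ∀ v : K3Index → ℤ, ∃ w : K3Index → ℚ,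
      k3ReflectionC wV (fun i => (v i : ℂ)) = fun i => (w i : ℂ) := fun v =>
    ⟨reflection k3FormRat (fun j => (wV j : ℚ)) (fun i => (v i : ℚ)), by
      rw [intCast_eq_ratCast_intCast v, k3ReflectionC_ratCast]⟩
  have hMsrat := ratEnd_mul M (k3ReflectionC wV) hMrat hsrat
  have hMsc : ∀ a b, k3Form ((M * k3ReflectionC wV) a) ((M * k3ReflectionC wV) b) = c * k3Form a b := by
    intro a b
    rw [Module.End.mul_apply, Module.End.mul_apply, hMc, k3Form_k3ReflectionC]
  obtain ⟨t₁, ht₁⟩ := smul_period_of_withoutHtypeAt hP hI hM hdR hG μ hμ h M hMrat hMc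
  obtain ⟨t₂, ht₂⟩ :=
    smul_period_of_withoutHtypeAt hP hI hM hdR hG μ hμ h (M * k3ReflectionC wV) hMsrat hMsc
  rw [Module.End.mul_apply] at ht₂
  -- cancel `M` with its left inverse `N`: `x₀ = t₁ • N x₀`, `s_w x₀ = t₂ • N x₀`
  have hx0 : (x₀P) ≠ 0 := ne_zero_of_star_self_re_pos x₀P_pos
  have hN1 : N (M x₀P) = x₀P := by rw [← Module.End.mul_apply, hNM, Module.End.one_apply]
  have hN2 : N (M (k3ReflectionC wV x₀P)) = k3ReflectionC wV x₀P := by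
    rw [← Module.End.mul_apply, hNM, Module.End.one_apply]
  rw [ht₁, map_smul] at hN1
  rw [ht₂, map_smul] at hN2
  have ht₁0 : t₁ ≠ 0 := by
    rintro rfl
    rw [zero_smul] at hN1
    exact hx0 hN1.symm
  refine reflection_x₀P_ne_smul (t₂ * t₁⁻¹) ?_
  calc k3ReflectionC wV x₀P = t₂ • N x₀P := hN2.symm
    _ = t₂ • (t₁⁻¹ • (t₁ • N x₀P)) := by rw [smul_smul t₁⁻¹ t₁, inv_mul_cancel₀ ht₁0, one_smul]
    _ = (t₂ * t₁⁻¹) • x₀P := by rw [hN1, smul_smul]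

/-- **`htype` is load-bearing for X = `TwinSimilitudeAlgebraic` (multiplier 2).** The crux X with
its type-preservation hypothesis dropped (`XWithoutHtypeAt[(2 : ℂ)]`, everything else verbatim) is
FALSE, modulo the five named facts and for every orientation family with Poincaré duality: feed the
explicit rational lattice `2`-similitude `M` with rational inverse `N` of
`exists_twoSimilitude_k3Lattice` (sum/difference on `E₈(−1)²`, `diag(1,2)` on `U³`) to
`withoutHtypeAt_false_of_latticeSimilitude`. So any proof of X must use `htype`.
[cite: VoisinHodgeI2002, §7.3.2 and Prop. 11.20] [cite: Huybrechts2016K3, Ch. 6 Rem. 3.3] -/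
theorem twinSimilitudeAlgebraic_false_without_htype
    (hP : Huybrechts_K3_periodSurjective_projective)
    (hI : hodgePQ_independent_of_hodgeModel)
    (hM : ∀ (m : ℕ) (Y : SchemeOver ℂ), nonempty_hodgeModel m Y)
    (hdR : ∀ (E : Type) [NormedAddCommGroup E] [NormedSpace ℂ E] [FiniteDimensional ℂ E],
      exists_deRhamIsoFamily 𝓘(ℝ, E))
    (hG : Grothendieck1969_supportedClasses_le_hodgeConiveau)
    (μ : OrientationFamily) (hμ : μ.HasPoincareDuality) :
    ¬ XWithoutHtypeAt[(2 : ℂ)] := by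
  obtain ⟨M, N, hMrat, -, -, hNM, hM2⟩ := exists_twoSimilitude_k3Lattice
  exact withoutHtypeAt_false_of_latticeSimilitude hP hI hM hdR hG μ hμ M N hMrat hNM hM2

end Summit.HodgeConjecture.HodgeConjecture.Theorems.TwinSimilitudeAlgebraic.Negative

end
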